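import Summits.HodgeConjecture.HodgeConjecture.Theses.AnchorTransport
import Summits.HodgeConjecture.HodgeConjecture.Theses.QbarEnvelope
import Summits.HodgeConjecture.HodgeConjecture.Theorems.AnchorTransportTargetIffHodgeConjecture
import Summits.HodgeConjecture.HodgeConjecture.Theorems.AnchorTransportAnchorExistenceTransport
import Summits.HodgeConjecture.HodgeConjecture.Theorems.AnchorExistence.Negative.LoadBearing
import Summits.HodgeConjecture.HodgeConjecture.Theorems.AnchorExistence.Negative.ConstantClause
import Summits.HodgeConjecture.HodgeConjecture.Theorems.AnchorExistence.Negative.IsotrivialStrengthening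
import Summits.HodgeConjecture.HodgeConjecture.Theorems.AnchorTransportAnchorExistenceQbarFibreAnchors
import Summits.HodgeConjecture.HodgeConjecture.Theorems.AnchorTransportAnchorExistenceQbarFibreAssembly
import Summits.HodgeConjecture.HodgeConjecture.Theorems.QbarEnvelopeEnvelopeStubNumberFieldModel
import Summits.HodgeConjecture.HodgeConjecture.Theorems.AnchorTransportAnchorExistenceStubDefinableOfRigid

/-!
# Route AnchorTransport — crux `AnchorExistence` (item stmt-HodgeConjecture-1077): LINE SKELETON `qbar-fibre-anchors`

Crux-strategist line (wall-breaker seat `cstrat-stmt-HodgeConjecture-1077-p1`, 2026-08-17), card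
`Cruxes/AnchorExistence/Lines/qbar-fibre-anchors.md`.

THE WALL (theorem-certified by leads c3/c4/a2 and triage r1/r2): every line for `AnchorExistence` must pay
the Hodge conjecture on An-RIGID pairs (all Hodge-class-carrying families through `(X, c)` have every fibre
isomorphic to `X`: expected examples from print — squares of rigid Calabi–Yau threefolds, compact ball quotients,
isolated Hodge-locus points; none constructed in the tree), because there an anchor IS the Hodge conjecture (`anchorTransport_mem_algebraicClasses_of_anchor_of_fiberIso`,
`Negative/ConstantClause`, `ChainAnchor.forall_stuck_chainAnchorAt_iff`).  Lines `Sketch` and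
`Sketch-peel-to-zero` died because they paid it with a complement stub of their own (HC verbatim there).

THE DOOR (this line): rigid pairs are `ℚ̄`-PAIRS.  An extrinsically rigid variety is definable over a number
field (spread `X` out over a `ℚ̄`-variety; every fibre is `≅ X`; take a `ℚ̄`-fibre), so the Hodge conjecture
it needs is the Hodge conjecture OVER NUMBER FIELDS — which is ALREADY a filed, shared crux of this summit,
`QbarEnvelope.HCOverNumberFields` (item stmt-HodgeConjecture-1070), imported here BY NAME exactly as line
`Sketch-peel-to-zero` imported `VariationalHodge` (stmt-1076) and as triage r2-1 recommended ("route the core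
instead of importing it … every HC-hard atom an already-filed shared crux").  And once anchors are paid in the
currency "fibre definable over `ℚ̄`" instead of "fibre where the class is KNOWN algebraic", the anchor
GEOGRAPHY becomes the weakest statement that still closes the crux: every Hodge pair deforms, inside one smooth
projective family carrying one global fibrewise-Hodge class, to a fibre DEFINABLE OVER A NUMBER FIELD.  This is
implied by the old special-point geography (CM / Fermat members are `ℚ̄`-points), by the `ℚ̄`-definability of
Hodge loci (Voisin 2007: weakly absolute Hodge classes; Klingler–Otwinowska–Urbanik 2023 in positive period
dimension) since `ℚ̄`-points are DENSE on a `ℚ̄`-subvariety — so the Baldi–Klingler–Ullmo sparsity of special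
points, the crux's named counter-pressure, no longer bites — and by `QbarEnvelope.Envelope` (stmt-1069)
through Hilbert schemes; it is implied by each (converses not claimed).

SKELETON (the strategist's v1–v3 cut, kept in hypothesis form): `AnchorExistence_of` concludes the crux from
four named HYPOTHESES by a kernel-checked case split on the EXTRINSIC RIGIDITY of `X` (every fibre of every
smooth projective family through `X` over a smooth irreducible base is `≅ X`) and the PAIR RIGIDITY of `(X, c)`
(the same for Hodge-class-carrying families); `anchorExistence_proof` now closes via the T+C+D packaging of the
LEAD c5 block below, not via this case split:
* `stub_hcOverNumberFields : QbarEnvelope.HCOverNumberFields` — the shared crux stmt-1070, by name (registered stub);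
* `stub_definable_of_rigid` — an extrinsically rigid smooth projective `X` is definable over a number field
  (KNOWN in print: spreading out + criterion "finitely many conjugates" / Kodaira–Spencer; González-Diez 2006,
  Shimura); LANDED (p145767) — declared below as a theorem, no longer a debt;
* (v3's `stub_definable_of_pairRigid`; now a hypothesis of `AnchorExistence_of` only, not declared) THE DARK CASE: `X` extrinsically movable but `(X, c)` pair-rigid
  (an isolated point of the locus of Hodge classes) ⟹ `X` is definable over a number field ("isolated Hodge
  points are `ℚ̄`-points": Voisin 2007 p. 2, open; true for algebraic `c` by Hilbert schemes; shared in
  substance with QbarEnvelope's zero-period-dimension case and crux QbarGenericIsHodgeGeneric);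
* (v3's `stub_qbarFibreAnchor_of_pairMovable`; now a hypothesis of `AnchorExistence_of` only, not declared) THE GEOGRAPHY, in `ℚ̄`-form: a pair-movable Hodge pair deforms (one
  family, one global fibrewise-Hodge class) to a fibre definable over a number field.
Glue: rigid `X` ⟹ (hypothesis 2) `X ≅ X₀ ⊗_σ ℂ` ⟹ (hypothesis 1) `c` algebraic ⟹ constant-family anchor
(`anchorTransport_anchor_of_mem_algebraicClasses`); movable `X`, pair-rigid ⟹ (hypothesis 3) same; pair-movable ⟹
(hypothesis 4) a datum with `ℚ̄`-fibre `𝒳_{s₀}`, smooth projective of dimension `n`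
(`IsSmoothProjectiveFamily.isSmoothProjective`), on which `A|_{𝒳_{s₀}}` is a rational `(p,p)` class, hence
algebraic by hypothesis 1 — an anchor datum.  No `VariationalHodge`, no complement stub, no sector list.

DISPROOF USED (`Cruxes/AnchorExistence/Disproof.lean`, the three `Negative/` files are imported below):
`anchorExistence_false_without_isRationalClass` / `anchorExistenceWithoutIsOfHodgeType_false_of` — honoured:
both class hypotheses are kept and USED (stmt-1070 is applied to `A|_{𝒳_{s₀}}` through `(hfib s₀).1/.2` and to `c`
through `hc`/`hpp`); `Negative/ConstantClause.anchor_over_specOver_iff` — the line's constant-family anchors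
occur exactly where it has first PROVED `c` algebraic (rigid / pair-rigid branches, via hypotheses 2/3 + 1);
`Negative/IsotrivialStrengthening` — not leaned on (no `s₁ ≠ s₀` claim); tightness
`anchorTransport_mem_algebraicClasses_of_anchor_of_fiberIso` — ANSWERED rather than dodged: on rigid pairs the
anchor fibre is `≅ X`, and the Hodge conjecture there is paid by stmt-1070 because `X` is over `ℚ̄` (hypotheses 2/3).

LEAD c5 (2026-08-17) — SKELETON v4, THE LINE'S END STATE: the crux BOUNDED ABOVE by existing debts (one direction).  Wave 1 landed
N = stmt-1069's `stub_numberFieldModel` (p145483), the split glue `HCOverNumberFields ∧ ℚ̄-fibre anchors →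
AnchorExistence` (`Theorems/AnchorTransportAnchorExistenceQbarFibreAnchors.lean`, p145614), stub 2
`stub_definable_of_rigid` (descent of extrinsically rigid varieties), and the REDUCTION of the ℚ̄-geography to
the shared transcendence kernel: ℚ̄-fibre anchors for EVERY Hodge pair ⟸ T + C + D + N
(`Theorems/AnchorTransportAnchorExistenceQbarFibreMechanism.lean`, p146731, and
`Theorems/AnchorTransportAnchorExistenceQbarFibreAssembly.lean`, landing with this skeleton: the family form of
Voisin's funnel).  Hence the registered (sorried) stubs are now four: `stub_hcOverNumberFields` (= stmt-1070),
`stub_typeStabilityAtQbarGenericZariskiLocal` (T, VERBATIM stmt-1069's registered stub; cf. PeriodDeficiency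
stmt-11595 — no formal comparison; the PeriodDeficiency typing proved in the Assembly replaces T by
11595 ∧ 11597 ∧ the BKU fact), `stub_riemannExistenceQbarDescent` (C, named fact), `stub_deligneGlobalInvariantCycles` (D, typed BY NAME as the
route item `AnchorTransport.DeligneGlobalInvariantCycles`, stmt-16363, per route-choice 2026-08-17); plus the landed `stub_definable_of_rigid` (no longer a debt; kept for the T-free rigid sector
`anchor_of_rigid`).
The former stubs 3 (dark case) and 4 (ℚ̄-geography) are no longer registered: both are IMPLIED by the sibling's
package T+C+D+N because `X` sits over the ℚ̄-GENERIC point of its own spread, where T applies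
(`definable_of_pairRigid_of_qbarFibreAnchors`,
`qbarFibreAnchors_of_typeStability_of_riemannExistence_of_globalInvariantCycles`); strictness of that
implication is unproven, the dark case remains the named open statement in print (cf. PeriodDeficiency
stmt-11594, no formal link), and there is no formal claim that `AnchorExistence ⇒ QFA` or `QFA ⇒ T`.  The last section keeps the
kernel-checked ℚ̄-fibre-anchor normal form (QFA ⟺ rigid ∧ dark ∧ movable sectors).
-/

noncomputable section

set_option linter.dupNamespace false

open CategoryTheory AlgebraicGeometry
open Literature.AlgebraicGeometry Literature.AlgebraicGeometry.Motives
  Literature.AlgebraicGeometry.HodgeTheory Literature.AlgebraicTopology.SingularHomology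
open Summit.HodgeConjecture.HodgeConjecture.Theses.AnchorTransport
open Summit.HodgeConjecture.HodgeConjecture.Theorems

namespace Summit.HodgeConjecture.HodgeConjecture.Cruxes.AnchorExistence.QbarFibreAnchors

/-! ### The three notions the stubs are cut along (documentation only: the stubs INLINE them, so that every
registered signature is stated over existing declarations) -/

/-- `X` (smooth projective of dimension `n`) is **definable over a number field**: `X ≅ X₀ ⊗_{K,σ} ℂ` for a
number field `K`, an embedding `σ : K →+* ℂ` and a `K`-scheme `X₀` — verbatim the hypothesis of the shared
crux `QbarEnvelope.HCOverNumberFields`. [cite: Voisin2007HodgeLoci, Rem. 1.4] -/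
def IsDefinableOverNumberField (X : SchemeOver ℂ) : Prop :=
  ∃ (K : Type) (_ : Field K) (_ : NumberField K) (σ : K →+* ℂ) (X₀ : SchemeOver K),
    Nonempty (X ≅ (baseChangeHom σ).obj X₀)

/-- `X` is **extrinsically rigid** in dimension `n`: every fibre of every smooth projective family of relative
dimension `n` over a smooth irreducible base having `X` as a fibre is isomorphic to `X` (the shape taken by
infinitesimally rigid non-uniruled varieties — Kodaira–Spencer local triviality + Matsusaka–Mumford — typed
without deformation theory). [cite: BaldiKlinglerUllmo2024, Thm. 2.3] -/
def IsExtrinsicallyRigid (n : ℕ) (X : SchemeOver ℂ) : Prop :=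
  ∀ ⦃𝒳 S : SchemeOver ℂ⦄ (f : 𝒳 ⟶ S) (s₁ s₀ : ComplexPoints S),
    IsSmoothProjectiveFamily f n → IrreducibleSpace S.left → AlgebraicGeometry.Smooth S.hom →
    Nonempty (X ≅ fiberOver f s₁) → Nonempty (X ≅ fiberOver f s₀)

/-- `(X, c)` is **pair-rigid**: every fibre of every smooth projective family through `X ≅ 𝒳_{s₁}` carrying a
GLOBAL class `A`, fibrewise rational of type `(p,p)`, with `e^*(A|_{𝒳_{s₁}}) = c` — i.e. every
Hodge-class-preserving algebraic deformation of the pair — is isomorphic to `X` (an isolated point of the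
locus of Hodge classes, up to isotriviality). [cite: Voisin2007HodgeLoci, §1] -/
def IsPairRigid (n p : ℕ) (X : SchemeOver ℂ) (c : complexBetti X (2 * p)) : Prop :=
  ∀ ⦃𝒳 S : SchemeOver ℂ⦄ (f : 𝒳 ⟶ S) (s₁ s₀ : ComplexPoints S) (e : X ≅ fiberOver f s₁)
    (A : complexBetti 𝒳 (2 * p)),
    IsSmoothProjectiveFamily f n → IrreducibleSpace S.left → AlgebraicGeometry.Smooth S.hom →
    (∀ s : ComplexPoints S, IsRationalClass (complexBetti.map (fiberι f s) (2 * p) A) ∧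
      IsOfHodgeType n (fiberOver f s) (2 * p) p p (complexBetti.map (fiberι f s) (2 * p) A)) →
    complexBetti.map e.hom (2 * p) (complexBetti.map (fiberι f s₁) (2 * p) A) = c →
    Nonempty (X ≅ fiberOver f s₀)

/-- An extrinsically rigid variety is pair-rigid for every class (forget the global class). [folklore] -/
theorem isPairRigid_of_isExtrinsicallyRigid {n p : ℕ} {X : SchemeOver ℂ} {c : complexBetti X (2 * p)}
    (h : IsExtrinsicallyRigid n X) : IsPairRigid n p X c :=
  fun _ _ f s₁ s₀ e _ hf hirr hsm _ _ ↦ h f s₁ s₀ hf hirr hsm ⟨e⟩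

/-! ### The four registered stubs -/

/-- STUB 1 (SHARED CRUX, by name — item stmt-HodgeConjecture-1070 of route QbarEnvelope): the Hodge
conjecture for smooth projective complex varieties definable over a number field.  Imported, not restated:
the one HC-hard atom every line for `AnchorExistence` must pay (the rigid core) is paid through an
already-filed, already-staffed shared item, as triage r2-1 asked. [cite: Voisin2007HodgeLoci, Prop. 1.2] -/
theorem stub_hcOverNumberFields :
    Summit.HodgeConjecture.HodgeConjecture.Theses.QbarEnvelope.HCOverNumberFields := by
  sorry

/-- STUB 2 (DESCENT OF RIGID VARIETIES — known in print, the line's first landable stub): an extrinsically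
rigid smooth projective complex variety is definable over a number field.  Proof in print: spread `X` out as a
fibre of a smooth projective family over a smooth geometrically irreducible `ℚ̄`-variety `B`; by rigidity
every complex fibre is `≅ X`; a `ℚ̄`-point of `B` (Nullstellensatz) gives the model (equivalently:
González-Diez's criterion — finitely many isomorphism classes among the conjugates `X^τ`, `τ ∈ Aut(ℂ/ℚ̄)`).
[cite: Voisin2007HodgeLoci, §3] [cite: KlinglerOtwinowskaUrbanik2023, Thm. 1.12] -/
theorem stub_definable_of_rigid :
    ∀ ⦃n : ℕ⦄ ⦃X : SchemeOver ℂ⦄, IsSmoothProjective n X →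
      (∀ ⦃𝒳 S : SchemeOver ℂ⦄ (f : 𝒳 ⟶ S) (s₁ s₀ : ComplexPoints S),
        IsSmoothProjectiveFamily f n → IrreducibleSpace S.left → AlgebraicGeometry.Smooth S.hom →
        Nonempty (X ≅ fiberOver f s₁) → Nonempty (X ≅ fiberOver f s₀)) →
      ∃ (K : Type) (_ : Field K) (_ : NumberField K) (σ : K →+* ℂ) (X₀ : SchemeOver K),
        Nonempty (X ≅ (baseChangeHom σ).obj X₀) :=
  -- LANDED (p145767, worker of lead c5): `Theorems/AnchorTransportAnchorExistenceStubDefinableOfRigid.lean`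
  _root_.Summit.HodgeConjecture.HodgeConjecture.Theorems.QbarFibreAnchors.stub_definable_of_rigid

/-- STUB T (SHARED TRANSCENDENCE KERNEL — VERBATIM the registered stub `stub_typeStabilityAtQbarGenericZariskiLocal`
of the sibling crux stmt-HodgeConjecture-1069, `Cruxes/Envelope/Lines/birth.lean`; in substance PeriodDeficiency's
`QbarGenericIsHodgeGeneric`, stmt-11595, at generic points): type stability at `ℚ̄`-generic points, Zariski-locally
on the base — for `σ : ℚ̄ →+* ℂ`, a `ℚ̄`-morphism `f₀ : 𝒳₀ ⟶ S₀` of quasi-projective `ℚ̄`-schemes with `S₀` smooth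
irreducible whose complexification is a smooth projective family of relative dimension `n`, a complex point `s`
over the GENERIC point of `S₀` and a rational `(p,p)` class `α` on `𝒳_s`, there is a proper Zariski-closed
`Z₀ ⊊ S₀` such that every flat continuation of `α` along a loop at `s` over `S₀ ∖ Z₀` is again of type `(p,p)`.
OPEN (KOU Conj. 1.5 (a) at generic points; known for weakly non-factor positive period dimension, KOU Thm 1.12);
implied by HC and by "Hodge classes are weakly absolute" (Voisin 2007 Thm 0.5 (2)).  With C, D and the landed N
it gives `ℚ̄`-fibre anchors for EVERY Hodge pair (`QbarFibreAnchors.qbarFibreAnchors_of_typeStability_of_riemannExistence_of_globalInvariantCycles`,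
`Theorems/AnchorTransportAnchorExistenceQbarFibreAssembly.lean`) — the dark case included, because `X` sits over
the `ℚ̄`-generic point of its own spread. [cite: Voisin2007HodgeLoci, Thm. 0.5 (2) and Prop. 1.7]
[cite: KlinglerOtwinowskaUrbanik2023, Conj. 1.5 (a) and Thm. 1.12] -/
theorem stub_typeStabilityAtQbarGenericZariskiLocal :
    ∀ (σ : AlgebraicClosure ℚ →+* ℂ) ⦃𝒳₀ S₀ : SchemeOver (AlgebraicClosure ℚ)⦄ (f₀ : 𝒳₀ ⟶ S₀)
      (n p : ℕ), IsQuasiProjectiveOver 𝒳₀ → IsQuasiProjectiveOver S₀ → IrreducibleSpace S₀.left →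
      AlgebraicGeometry.Smooth S₀.hom → IsSmoothProjectiveFamily ((baseChangeHom σ).map f₀) n →
      ∀ (s : ComplexPoints ((baseChangeHom σ).obj S₀)),
        closure {(baseChangeHomFst σ S₀).base s.pt} = (Set.univ : Set S₀.left) →
        ∀ (α : complexBetti (fiberOver ((baseChangeHom σ).map f₀) s) (2 * p)),
          IsRationalClass α → IsOfHodgeType n (fiberOver ((baseChangeHom σ).map f₀) s) (2 * p) p p α →
          ∃ Z₀ : Set S₀.left, IsClosed Z₀ ∧ Z₀ ≠ Set.univ ∧
            ∀ (γ : Path s s), (∀ u, (baseChangeHomFst σ S₀).base (γ u).pt ∉ Z₀) →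
              ∀ (β : complexBetti (fiberOver ((baseChangeHom σ).map f₀) s) (2 * p)),
                IsContinuationAlong γ α β →
                  IsOfHodgeType n (fiberOver ((baseChangeHom σ).map f₀) s) (2 * p) p p β := by
  sorry

/-- STUB C (NAMED LITERATURE FACT, by name): Riemann existence with `ℚ̄`-descent of finite-index subgroups —
a finite-index subgroup of `π₁` of the complexification of a smooth irreducible quasi-projective `ℚ̄`-scheme is
realised by a finite étale cover DEFINED OVER `ℚ̄` (SGA1 XII 5.1 + XIII 4.6); unproved in the tree, reduced there
to stmt-1069's registered `stub_locallyAlgebraicSeparatingSmoothAffineDimGeTwo`. [cite: SGA1, Exp. XII Thm. 5.1 and Exp. XIII Cor. 4.6] -/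
theorem stub_riemannExistenceQbarDescent :
    Literature.AlgebraicGeometry.FundamentalGroup.riemannExistence_qbarDescent_of_finiteIndex := by
  sorry

/-- STUB D (SHARED ROUTE ITEM stmt-HodgeConjecture-16363, by name — `AnchorTransport.DeligneGlobalInvariantCycles`,
filed on this route by route-choice 2026-08-17; VERBATIM the body of the named Literature fact
`deligne_globalInvariantCycles`, so it feeds the Assembly by δ-unfolding): Deligne's global invariant cycle theorem /
théorème de la partie fixe, pointwise form on the tree's carriers (Hodge II Thm 4.1.1). [cite: DeligneHodgeII1971, Thm. 4.1.1] -/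
theorem stub_deligneGlobalInvariantCycles :
    Summit.HodgeConjecture.HodgeConjecture.Theses.AnchorTransport.DeligneGlobalInvariantCycles := by
  sorry

/-! ### The registered signatures ARE the named notions (by `Iff.rfl`) -/

/-- Stub 2 is `IsExtrinsicallyRigid n X → IsDefinableOverNumberField X` (by `Iff.rfl`). [folklore] -/
theorem stub_definable_of_rigid_iff :
    (∀ ⦃n : ℕ⦄ ⦃X : SchemeOver ℂ⦄, IsSmoothProjective n X → IsExtrinsicallyRigid n X →
        IsDefinableOverNumberField X) ↔
      ∀ ⦃n : ℕ⦄ ⦃X : SchemeOver ℂ⦄, IsSmoothProjective n X →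
        (∀ ⦃𝒳 S : SchemeOver ℂ⦄ (f : 𝒳 ⟶ S) (s₁ s₀ : ComplexPoints S),
          IsSmoothProjectiveFamily f n → IrreducibleSpace S.left → AlgebraicGeometry.Smooth S.hom →
          Nonempty (X ≅ fiberOver f s₁) → Nonempty (X ≅ fiberOver f s₀)) →
        ∃ (K : Type) (_ : Field K) (_ : NumberField K) (σ : K →+* ℂ) (X₀ : SchemeOver K),
          Nonempty (X ≅ (baseChangeHom σ).obj X₀) :=
  Iff.rfl

/-! ### Kernel-checked composition: the four stubs conclude the crux BY NAME -/

/-- **The rigid core is paid by the shared crux**: stubs 1 + 2 give the Hodge conjecture for every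
extrinsically rigid smooth projective `X` — so this line owns NO complement stub on rigid pairs (the sector
where `Sketch` / `Sketch-peel-to-zero` were the Hodge conjecture verbatim). [cite: Voisin2007HodgeLoci, Prop. 1.2] -/
theorem hodgeConjectureFor_of_rigid
    (hC1 : Summit.HodgeConjecture.HodgeConjecture.Theses.QbarEnvelope.HCOverNumberFields)
    (hR : ∀ ⦃n : ℕ⦄ ⦃X : SchemeOver ℂ⦄, IsSmoothProjective n X → IsExtrinsicallyRigid n X →
      IsDefinableOverNumberField X)
    {n : ℕ} {X : SchemeOver ℂ} (hX : IsSmoothProjective n X) (hrig : IsExtrinsicallyRigid n X) :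
    HodgeConjectureFor n X :=
  hC1 hX (hR hX hrig)

/-- **`AnchorExistence` from the four stubs** (the composition; conclusion literally the route decl).
Case split on extrinsic rigidity of `X`, then on pair rigidity of `(X, c)`: in the two rigid cases `X` is
definable over a number field (hypotheses 2 / 3), the shared crux (hypothesis 1) makes `c` algebraic and the constant
family anchors it (`anchorTransport_anchor_of_mem_algebraicClasses`); in the pair-movable case stub 4 gives a
family with a `ℚ̄`-fibre `𝒳_{s₀}`, smooth projective of dimension `n` (`IsSmoothProjectiveFamily.isSmoothProjective`),
on which `A|_{𝒳_{s₀}}` is a rational `(p,p)` class, hence algebraic by hypothesis 1 — an anchor datum.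
[cite: Voisin2007HodgeLoci, Prop. 1.2 and Thm. 0.5] [cite: CharlesSchnell2014Notes, Conj. 11.3.1] -/
theorem AnchorExistence_of :
    Summit.HodgeConjecture.HodgeConjecture.Theses.QbarEnvelope.HCOverNumberFields →
    (∀ ⦃n : ℕ⦄ ⦃X : SchemeOver ℂ⦄, IsSmoothProjective n X →
      (∀ ⦃𝒳 S : SchemeOver ℂ⦄ (f : 𝒳 ⟶ S) (s₁ s₀ : ComplexPoints S),
        IsSmoothProjectiveFamily f n → IrreducibleSpace S.left → AlgebraicGeometry.Smooth S.hom →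
        Nonempty (X ≅ fiberOver f s₁) → Nonempty (X ≅ fiberOver f s₀)) →
      ∃ (K : Type) (_ : Field K) (_ : NumberField K) (σ : K →+* ℂ) (X₀ : SchemeOver K),
        Nonempty (X ≅ (baseChangeHom σ).obj X₀)) →
    (∀ ⦃n : ℕ⦄ ⦃X : SchemeOver ℂ⦄, IsSmoothProjective n X →
      ¬ (∀ ⦃𝒳 S : SchemeOver ℂ⦄ (f : 𝒳 ⟶ S) (s₁ s₀ : ComplexPoints S),
        IsSmoothProjectiveFamily f n → IrreducibleSpace S.left → AlgebraicGeometry.Smooth S.hom →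
        Nonempty (X ≅ fiberOver f s₁) → Nonempty (X ≅ fiberOver f s₀)) →
      ∀ (p : ℕ) (c : complexBetti X (2 * p)), IsRationalClass c → IsOfHodgeType n X (2 * p) p p c →
      (∀ ⦃𝒳 S : SchemeOver ℂ⦄ (f : 𝒳 ⟶ S) (s₁ s₀ : ComplexPoints S) (e : X ≅ fiberOver f s₁)
          (A : complexBetti 𝒳 (2 * p)),
        IsSmoothProjectiveFamily f n → IrreducibleSpace S.left → AlgebraicGeometry.Smooth S.hom →
        (∀ s : ComplexPoints S, IsRationalClass (complexBetti.map (fiberι f s) (2 * p) A) ∧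
          IsOfHodgeType n (fiberOver f s) (2 * p) p p (complexBetti.map (fiberι f s) (2 * p) A)) →
        complexBetti.map e.hom (2 * p) (complexBetti.map (fiberι f s₁) (2 * p) A) = c →
        Nonempty (X ≅ fiberOver f s₀)) →
      ∃ (K : Type) (_ : Field K) (_ : NumberField K) (σ : K →+* ℂ) (X₀ : SchemeOver K),
        Nonempty (X ≅ (baseChangeHom σ).obj X₀)) →
    (∀ ⦃n : ℕ⦄ ⦃X : SchemeOver ℂ⦄, IsSmoothProjective n X →
      ∀ (p : ℕ) (c : complexBetti X (2 * p)), IsRationalClass c → IsOfHodgeType n X (2 * p) p p c →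
      ¬ (∀ ⦃𝒳 S : SchemeOver ℂ⦄ (f : 𝒳 ⟶ S) (s₁ s₀ : ComplexPoints S) (e : X ≅ fiberOver f s₁)
          (A : complexBetti 𝒳 (2 * p)),
        IsSmoothProjectiveFamily f n → IrreducibleSpace S.left → AlgebraicGeometry.Smooth S.hom →
        (∀ s : ComplexPoints S, IsRationalClass (complexBetti.map (fiberι f s) (2 * p) A) ∧
          IsOfHodgeType n (fiberOver f s) (2 * p) p p (complexBetti.map (fiberι f s) (2 * p) A)) →
        complexBetti.map e.hom (2 * p) (complexBetti.map (fiberι f s₁) (2 * p) A) = c →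
        Nonempty (X ≅ fiberOver f s₀)) →
      ∃ (𝒳 S : SchemeOver ℂ) (f : 𝒳 ⟶ S) (s₁ s₀ : ComplexPoints S) (e : X ≅ fiberOver f s₁)
        (A : complexBetti 𝒳 (2 * p)),
        IsSmoothProjectiveFamily f n ∧ IrreducibleSpace S.left ∧ AlgebraicGeometry.Smooth S.hom ∧
        (∀ s : ComplexPoints S, IsRationalClass (complexBetti.map (fiberι f s) (2 * p) A) ∧
          IsOfHodgeType n (fiberOver f s) (2 * p) p p (complexBetti.map (fiberι f s) (2 * p) A)) ∧
        complexBetti.map e.hom (2 * p) (complexBetti.map (fiberι f s₁) (2 * p) A) = c ∧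
        ∃ (K : Type) (_ : Field K) (_ : NumberField K) (σ : K →+* ℂ) (X₀ : SchemeOver K),
          Nonempty (fiberOver f s₀ ≅ (baseChangeHom σ).obj X₀)) →
    AnchorExistence := by
  intro hC1 hR hD hQ n X hX p c hc hpp
  by_cases hrig : ∀ ⦃𝒳 S : SchemeOver ℂ⦄ (f : 𝒳 ⟶ S) (s₁ s₀ : ComplexPoints S),
      IsSmoothProjectiveFamily f n → IrreducibleSpace S.left → AlgebraicGeometry.Smooth S.hom →
      Nonempty (X ≅ fiberOver f s₁) → Nonempty (X ≅ fiberOver f s₀)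
  · -- extrinsically rigid: `X` is a `ℚ̄`-variety (hyp. 2); HC over number fields (hyp. 1); constant family
    exact anchorTransport_anchor_of_mem_algebraicClasses hX p c hc hpp ((hC1 hX (hR hX hrig)).2 p c hc hpp)
  by_cases hpr : ∀ ⦃𝒳 S : SchemeOver ℂ⦄ (f : 𝒳 ⟶ S) (s₁ s₀ : ComplexPoints S) (e : X ≅ fiberOver f s₁)
        (A : complexBetti 𝒳 (2 * p)),
      IsSmoothProjectiveFamily f n → IrreducibleSpace S.left → AlgebraicGeometry.Smooth S.hom →
      (∀ s : ComplexPoints S, IsRationalClass (complexBetti.map (fiberι f s) (2 * p) A) ∧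
        IsOfHodgeType n (fiberOver f s) (2 * p) p p (complexBetti.map (fiberι f s) (2 * p) A)) →
      complexBetti.map e.hom (2 * p) (complexBetti.map (fiberι f s₁) (2 * p) A) = c →
      Nonempty (X ≅ fiberOver f s₀)
  · -- pair-rigid (the dark case): again a `ℚ̄`-variety (hyp. 3); hyp. 1; constant family
    exact anchorTransport_anchor_of_mem_algebraicClasses hX p c hc hpp
      ((hC1 hX (hD hX hrig p c hc hpp hpr)).2 p c hc hpp)
  · -- pair-movable: a `ℚ̄`-fibre anchor (hyp. 4), whose fibre class is algebraic by hyp. 1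
    obtain ⟨𝒳, S, f, s₁, s₀, e, A, hf, hirr, hsm, hfib, hAc, hdef⟩ := hQ hX p c hc hpp hpr
    exact ⟨𝒳, S, f, s₁, s₀, e, A, hf, hirr, hsm, hfib, hAc,
      (hC1 (hf.isSmoothProjective s₀) hdef).2 p _ (hfib s₀).1 (hfib s₀).2⟩

/-- **Proof of the item modulo the registered stubs**: `AnchorExistence` BY NAME (sorries only inside the four
`stub_*`). [cite: CharlesSchnell2014Notes, Conj. 11.3.1] -/
theorem anchorExistence_proof : AnchorExistence :=
  _root_.Summit.HodgeConjecture.HodgeConjecture.Theorems.QbarFibreAnchors.anchorExistence_of_hcOverNumberFields_of_qbarFibreAnchors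
    stub_hcOverNumberFields
    (_root_.Summit.HodgeConjecture.HodgeConjecture.Theorems.QbarFibreAnchors.qbarFibreAnchors_of_typeStability_of_riemannExistence_of_globalInvariantCycles
      stub_typeStabilityAtQbarGenericZariskiLocal stub_riemannExistenceQbarDescent
      -- the route item stmt-16363 is the named fact's body verbatim: δ-unfolding, pointwise
      (fun 𝒳 Xbar S f i n m ↦ stub_deligneGlobalInvariantCycles 𝒳 Xbar S f i n m))

/-- **The rigid sector needs no transcendence input**: stubs 1 + 2 alone anchor every pair on an extrinsically
rigid `X` (`X` is a `ℚ̄`-variety by the landed stub 2, `c` algebraic by stub 1 = stmt-1070, constant family) — kept so that the T-free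
part of the line stays registered and visible. [cite: Voisin2007HodgeLoci, Prop. 1.2] -/
theorem anchor_of_rigid {n : ℕ} {X : SchemeOver ℂ} (hX : IsSmoothProjective n X) (hrig : IsExtrinsicallyRigid n X)
    (p : ℕ) (c : complexBetti X (2 * p)) (hc : IsRationalClass c) (hpp : IsOfHodgeType n X (2 * p) p p c) :
    ∃ (𝒳 S : SchemeOver ℂ) (f : 𝒳 ⟶ S) (s₁ s₀ : ComplexPoints S) (e : X ≅ fiberOver f s₁)
      (A : complexBetti 𝒳 (2 * p)),
      IsSmoothProjectiveFamily f n ∧ IrreducibleSpace S.left ∧ AlgebraicGeometry.Smooth S.hom ∧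
      (∀ s : ComplexPoints S, IsRationalClass (complexBetti.map (fiberι f s) (2 * p) A) ∧
        IsOfHodgeType n (fiberOver f s) (2 * p) p p (complexBetti.map (fiberι f s) (2 * p) A)) ∧
      complexBetti.map e.hom (2 * p) (complexBetti.map (fiberι f s₁) (2 * p) A) = c ∧
      complexBetti.map (fiberι f s₀) (2 * p) A ∈ algebraicClasses (fiberOver f s₀) p :=
  anchorTransport_anchor_of_mem_algebraicClasses hX p c hc hpp
    ((stub_hcOverNumberFields hX (stub_definable_of_rigid hX hrig)).2 p c hc hpp)

/-! ### Honesty checks (kernel-checked, no new sorry) -/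

/-- **Upper bound for the ℚ̄-geography's conclusion at a `ℚ̄`-fibre**: what stmt-1070 buys there is exactly an anchor —
if the anchor fibre of an anchor-SHAPED datum is definable over a number field, `HCOverNumberFields` turns it
into an anchor datum. (The pair-movable branch of `AnchorExistence_of`, isolated.) [cite: Voisin2007HodgeLoci, Prop. 1.2] -/
theorem anchor_of_qbarFibre
    (hC1 : Summit.HodgeConjecture.HodgeConjecture.Theses.QbarEnvelope.HCOverNumberFields)
    {n p : ℕ} {𝒳 S : SchemeOver ℂ} (f : 𝒳 ⟶ S) (s₀ : ComplexPoints S)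
    (A : complexBetti 𝒳 (2 * p)) (hf : IsSmoothProjectiveFamily f n)
    (hfib : ∀ s : ComplexPoints S, IsRationalClass (complexBetti.map (fiberι f s) (2 * p) A) ∧
      IsOfHodgeType n (fiberOver f s) (2 * p) p p (complexBetti.map (fiberι f s) (2 * p) A))
    (hdef : IsDefinableOverNumberField (fiberOver f s₀)) :
    complexBetti.map (fiberι f s₀) (2 * p) A ∈ algebraicClasses (fiberOver f s₀) p :=
  (hC1 (hf.isSmoothProjective s₀) hdef).2 p _ (hfib s₀).1 (hfib s₀).2

/-! ### The line's single new statement: ℚ̄-FIBRE ANCHORS (lead c5, 2026-08-17)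

The three non-shared stubs 2 ∧ 3 ∧ 4 are TOGETHER equivalent to one hypothesis-free statement, the
`ℚ̄`-fibre form of the crux: every Hodge pair `(X, c)` is carried by a Hodge datum one of whose fibres is
definable over a number field (`QbarFibreAnchorAt`).  Stub 4 is this statement restricted to pair-movable
pairs; stubs 2 and 3 are its extrinsically-rigid and pair-rigid instances READ BACKWARDS (on a rigid pair the
`ℚ̄`-fibre is `≅ X`, so `X` itself is a `ℚ̄`-variety) — and conversely a `ℚ̄`-variety anchors all its pairs by
the constant family.  So the line is `HCOverNumberFields (stmt-1070) ∧ QbarFibreAnchors → AnchorExistence`,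
and the strategist's cut isolates inside `QbarFibreAnchors` its KNOWN sector (stub 2: descent of rigid
varieties) and NAMES its dark sector (stub 3).  Kernel-checked below: `qbarFibreAnchors_of_stubs`,
`stub_definable_of_rigid_of_qbarFibreAnchors`, `stub_definable_of_pairRigid_of_qbarFibreAnchors`,
`stub_qbarFibreAnchor_of_pairMovable_of_qbarFibreAnchors`, `anchorExistence_of_hcOverNumberFields_of_qbarFibreAnchors`. -/

/-- **`ℚ̄`-fibre anchor at a pair `(X, c)`**: a Hodge datum through `(X, c)` (smooth projective family over a
smooth irreducible base, global class fibrewise rational of type `(p,p)` restricting to `c` through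
`e : X ≅ 𝒳_{s₁}`) together with a fibre `𝒳_{s₀}` DEFINABLE OVER A NUMBER FIELD — the `∃`-body of
`AnchorExistence` with "algebraic at `s₀`" replaced by "definable over a number field at `s₀`" (stub 4's
conclusion, for every pair). [cite: Voisin2007HodgeLoci, Prop. 1.7] -/
def QbarFibreAnchorAt (n p : ℕ) (X : SchemeOver ℂ) (c : complexBetti X (2 * p)) : Prop :=
  ∃ (𝒳 S : SchemeOver ℂ) (f : 𝒳 ⟶ S) (s₁ s₀ : ComplexPoints S) (e : X ≅ fiberOver f s₁)
    (A : complexBetti 𝒳 (2 * p)),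
    IsSmoothProjectiveFamily f n ∧ IrreducibleSpace S.left ∧ AlgebraicGeometry.Smooth S.hom ∧
    (∀ s : ComplexPoints S, IsRationalClass (complexBetti.map (fiberι f s) (2 * p) A) ∧
      IsOfHodgeType n (fiberOver f s) (2 * p) p p (complexBetti.map (fiberι f s) (2 * p) A)) ∧
    complexBetti.map e.hom (2 * p) (complexBetti.map (fiberι f s₁) (2 * p) A) = c ∧
    IsDefinableOverNumberField (fiberOver f s₀)

/-- Definability over a number field is transported along isomorphisms of `ℂ`-schemes. [folklore] -/
theorem isDefinableOverNumberField_of_iso {X Y : SchemeOver ℂ} (e : X ≅ Y)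
    (h : IsDefinableOverNumberField X) : IsDefinableOverNumberField Y := by
  obtain ⟨K, _, _, σ, X₀, ⟨e₀⟩⟩ := h
  exact ⟨K, inferInstance, inferInstance, σ, X₀, ⟨e.symm ≪≫ e₀⟩⟩

/-- **A `ℚ̄`-variety anchors all its pairs by the constant family**: if `X` itself is definable over a number
field, every class `c` on `X` has a `ℚ̄`-fibre anchor — the constant family `X ⟶ Spec ℂ`, `s₁ = s₀ = 𝟙`,
whose fibre is `≅ X` (`isIso_fiberι_toSpecOver`). [folklore] -/
theorem qbarFibreAnchorAt_of_isDefinableOverNumberField {n p : ℕ} {X : SchemeOver ℂ}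
    (hX : IsSmoothProjective n X) (c : complexBetti X (2 * p)) (hc : IsRationalClass c)
    (hpp : IsOfHodgeType n X (2 * p) p p c) (hdef : IsDefinableOverNumberField X) :
    QbarFibreAnchorAt n p X c := by
  haveI : ∀ s : AlgPoints (specOver ℂ ℂ) ℂ, IsIso (fiberι (toSpecOver X) s) :=
    isIso_fiberι_toSpecOver
  refine ⟨X, specOver ℂ ℂ, toSpecOver X, 𝟙 _, 𝟙 _, (asIso (fiberι (toSpecOver X) (𝟙 _))).symm, c,
    isSmoothProjectiveFamily_toSpecOver hX, irreducibleSpace_specOver_left, smooth_specOver_hom,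
    fun s ↦ ⟨?_, ?_⟩, ?_, ?_⟩
  · exact hc.pullback _
  · exact IsOfHodgeType.map_of_iso (asIso (fiberι (toSpecOver X) s)) hpp
  · change (complexBetti.map (asIso (fiberι (toSpecOver X) (𝟙 _))).hom (2 * p) ≫
      complexBetti.map (asIso (fiberι (toSpecOver X) (𝟙 _))).inv (2 * p)) c = c
    rw [← complexBetti.map_comp, Iso.inv_hom_id, complexBetti.map_id]
    rfl
  · exact isDefinableOverNumberField_of_iso (asIso (fiberι (toSpecOver X) (𝟙 _))).symm hdef

/-- **Pair-rigidity of the ZERO class is extrinsic rigidity** (so the dark-case hypotheses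
"`¬ IsExtrinsicallyRigid n X ∧ IsPairRigid n p X 0`" are contradictory: the former stub 3 was vacuous at `c = 0`;
the global class `A = 0` rides on every family). [folklore] -/
theorem isExtrinsicallyRigid_of_isPairRigid_zero {n p : ℕ} {X : SchemeOver ℂ}
    (h : IsPairRigid n p X 0) : IsExtrinsicallyRigid n X := by
  intro 𝒳 S f s₁ s₀ hf hirr hsm ⟨e⟩
  refine h f s₁ s₀ e 0 hf hirr hsm (fun s ↦ ⟨?_, ?_⟩) ?_
  · rw [map_zero]; exact IsRationalClass.zero
  · rw [map_zero]
    exact isOfHodgeType_zero_of_isSmoothProjective nonempty_hodgeModel_holds (hf.isSmoothProjective s) _ p p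
  · rw [map_zero, map_zero]

/-- **Stubs 2 ∧ 3 ∧ 4 ⟹ `ℚ̄`-fibre anchors for every pair** (case split on extrinsic / pair rigidity; the rigid
cases anchor by the constant family of the `ℚ̄`-variety `X`). [cite: Voisin2007HodgeLoci, Prop. 1.7] -/
theorem qbarFibreAnchors_of_stubs
    (hR : ∀ ⦃n : ℕ⦄ ⦃X : SchemeOver ℂ⦄, IsSmoothProjective n X → IsExtrinsicallyRigid n X →
      IsDefinableOverNumberField X)
    (hD : ∀ ⦃n : ℕ⦄ ⦃X : SchemeOver ℂ⦄, IsSmoothProjective n X → ¬ IsExtrinsicallyRigid n X →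
      ∀ (p : ℕ) (c : complexBetti X (2 * p)), IsRationalClass c → IsOfHodgeType n X (2 * p) p p c →
      IsPairRigid n p X c → IsDefinableOverNumberField X)
    (hQ : ∀ ⦃n : ℕ⦄ ⦃X : SchemeOver ℂ⦄, IsSmoothProjective n X →
      ∀ (p : ℕ) (c : complexBetti X (2 * p)), IsRationalClass c → IsOfHodgeType n X (2 * p) p p c →
      ¬ IsPairRigid n p X c → QbarFibreAnchorAt n p X c)
    {n : ℕ} {X : SchemeOver ℂ} (hX : IsSmoothProjective n X) (p : ℕ) (c : complexBetti X (2 * p))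
    (hc : IsRationalClass c) (hpp : IsOfHodgeType n X (2 * p) p p c) : QbarFibreAnchorAt n p X c := by
  by_cases hrig : IsExtrinsicallyRigid n X
  · exact qbarFibreAnchorAt_of_isDefinableOverNumberField hX c hc hpp (hR hX hrig)
  by_cases hpr : IsPairRigid n p X c
  · exact qbarFibreAnchorAt_of_isDefinableOverNumberField hX c hc hpp (hD hX hrig p c hc hpp hpr)
  · exact hQ hX p c hc hpp hpr

/-- **`ℚ̄`-fibre anchors ⟹ stub 4** (drop the pair-movability hypothesis; the conclusion is `QbarFibreAnchorAt`
unfolded). [cite: Voisin2007HodgeLoci, Prop. 1.7] -/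
theorem stub_qbarFibreAnchor_of_pairMovable_of_qbarFibreAnchors
    (h : ∀ ⦃n : ℕ⦄ ⦃X : SchemeOver ℂ⦄, IsSmoothProjective n X →
      ∀ (p : ℕ) (c : complexBetti X (2 * p)), IsRationalClass c → IsOfHodgeType n X (2 * p) p p c →
      QbarFibreAnchorAt n p X c) :
    ∀ ⦃n : ℕ⦄ ⦃X : SchemeOver ℂ⦄, IsSmoothProjective n X →
      ∀ (p : ℕ) (c : complexBetti X (2 * p)), IsRationalClass c → IsOfHodgeType n X (2 * p) p p c →
      ¬ IsPairRigid n p X c → QbarFibreAnchorAt n p X c :=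
  fun _ _ hX p c hc hpp _ ↦ h hX p c hc hpp

/-- **`ℚ̄`-fibre anchors ⟹ stub 3** (the dark case, read backwards): on a pair-rigid `(X, c)` the `ℚ̄`-fibre of
a `ℚ̄`-fibre anchor is `≅ X`, so `X` is definable over a number field. [cite: Voisin2007HodgeLoci, §0] -/
theorem stub_definable_of_pairRigid_of_qbarFibreAnchors
    (h : ∀ ⦃n : ℕ⦄ ⦃X : SchemeOver ℂ⦄, IsSmoothProjective n X →
      ∀ (p : ℕ) (c : complexBetti X (2 * p)), IsRationalClass c → IsOfHodgeType n X (2 * p) p p c →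
      QbarFibreAnchorAt n p X c) :
    ∀ ⦃n : ℕ⦄ ⦃X : SchemeOver ℂ⦄, IsSmoothProjective n X → ¬ IsExtrinsicallyRigid n X →
      ∀ (p : ℕ) (c : complexBetti X (2 * p)), IsRationalClass c → IsOfHodgeType n X (2 * p) p p c →
      IsPairRigid n p X c → IsDefinableOverNumberField X := by
  intro n X hX _ p c hc hpp hpr
  obtain ⟨𝒳, S, f, s₁, s₀, e, A, hf, hirr, hsm, hfib, hAc, hdef⟩ := h hX p c hc hpp
  obtain ⟨g⟩ := hpr f s₁ s₀ e A hf hirr hsm hfib hAc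
  exact isDefinableOverNumberField_of_iso g.symm hdef

/-- **`ℚ̄`-fibre anchors ⟹ stub 2** (extrinsic rigidity, read backwards on the pair `(X, 0)` in degree `0`: the
`ℚ̄`-fibre of its anchor is `≅ X`). [cite: Voisin2007HodgeLoci, §0] -/
theorem stub_definable_of_rigid_of_qbarFibreAnchors
    (h : ∀ ⦃n : ℕ⦄ ⦃X : SchemeOver ℂ⦄, IsSmoothProjective n X →
      ∀ (p : ℕ) (c : complexBetti X (2 * p)), IsRationalClass c → IsOfHodgeType n X (2 * p) p p c →
      QbarFibreAnchorAt n p X c) :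
    ∀ ⦃n : ℕ⦄ ⦃X : SchemeOver ℂ⦄, IsSmoothProjective n X → IsExtrinsicallyRigid n X →
      IsDefinableOverNumberField X := by
  intro n X hX hrig
  obtain ⟨𝒳, S, f, s₁, s₀, e, A, hf, hirr, hsm, -, -, hdef⟩ :=
    h hX 0 0 IsRationalClass.zero (isOfHodgeType_zero_of_isSmoothProjective nonempty_hodgeModel_holds hX _ 0 0)
  obtain ⟨g⟩ := hrig f s₁ s₀ hf hirr hsm ⟨e⟩
  exact isDefinableOverNumberField_of_iso g.symm hdef

/-- **The line in one sentence: `HCOverNumberFields ∧ QbarFibreAnchors → AnchorExistence`** (the shared crux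
stmt-1070 turns the `ℚ̄`-fibre of a `ℚ̄`-fibre anchor into an algebraic anchor, `anchor_of_qbarFibre`).
[cite: Voisin2007HodgeLoci, Prop. 1.2 and Prop. 1.7] -/
theorem anchorExistence_of_hcOverNumberFields_of_qbarFibreAnchors
    (hC1 : Summit.HodgeConjecture.HodgeConjecture.Theses.QbarEnvelope.HCOverNumberFields)
    (h : ∀ ⦃n : ℕ⦄ ⦃X : SchemeOver ℂ⦄, IsSmoothProjective n X →
      ∀ (p : ℕ) (c : complexBetti X (2 * p)), IsRationalClass c → IsOfHodgeType n X (2 * p) p p c →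
      QbarFibreAnchorAt n p X c) :
    AnchorExistence := by
  intro n X hX p c hc hpp
  obtain ⟨𝒳, S, f, s₁, s₀, e, A, hf, hirr, hsm, hfib, hAc, hdef⟩ := h hX p c hc hpp
  exact ⟨𝒳, S, f, s₁, s₀, e, A, hf, hirr, hsm, hfib, hAc, anchor_of_qbarFibre hC1 f s₀ A hf hfib hdef⟩

/-- **Lossless repackaging**: `ℚ̄`-fibre anchors for all pairs ⟺ stubs 2 ∧ 3 ∧ 4 (in their named forms).
[cite: Voisin2007HodgeLoci, Prop. 1.7] -/
theorem qbarFibreAnchors_iff_stubs :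
    (∀ ⦃n : ℕ⦄ ⦃X : SchemeOver ℂ⦄, IsSmoothProjective n X →
      ∀ (p : ℕ) (c : complexBetti X (2 * p)), IsRationalClass c → IsOfHodgeType n X (2 * p) p p c →
      QbarFibreAnchorAt n p X c) ↔
    ((∀ ⦃n : ℕ⦄ ⦃X : SchemeOver ℂ⦄, IsSmoothProjective n X → IsExtrinsicallyRigid n X →
        IsDefinableOverNumberField X) ∧
      (∀ ⦃n : ℕ⦄ ⦃X : SchemeOver ℂ⦄, IsSmoothProjective n X → ¬ IsExtrinsicallyRigid n X →
        ∀ (p : ℕ) (c : complexBetti X (2 * p)), IsRationalClass c → IsOfHodgeType n X (2 * p) p p c →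
        IsPairRigid n p X c → IsDefinableOverNumberField X) ∧
      (∀ ⦃n : ℕ⦄ ⦃X : SchemeOver ℂ⦄, IsSmoothProjective n X →
        ∀ (p : ℕ) (c : complexBetti X (2 * p)), IsRationalClass c → IsOfHodgeType n X (2 * p) p p c →
        ¬ IsPairRigid n p X c → QbarFibreAnchorAt n p X c)) :=
  ⟨fun h ↦ ⟨stub_definable_of_rigid_of_qbarFibreAnchors h, stub_definable_of_pairRigid_of_qbarFibreAnchors h,
      stub_qbarFibreAnchor_of_pairMovable_of_qbarFibreAnchors h⟩,
    fun h _ _ hX p c hc hpp ↦ qbarFibreAnchors_of_stubs h.1 h.2.1 h.2.2 hX p c hc hpp⟩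

end Summit.HodgeConjecture.HodgeConjecture.Cruxes.AnchorExistence.QbarFibreAnchors

end
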